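import Summits.QuantumAdvantage.QuantumAdvantage.Theorems.WalkThreeStepFreeSymmetry

/-!
# Rung (G♯₂) `ThreeStepFreeRungFive` (item stmt-QuantumAdvantage-23286), architecture (U): CLUSTER SPLITTING of the register differential
# (groundwork for the far-read lemma U-c1)

Cell qa-qnc0, route OddPrimeWalk, support item stmt-QuantumAdvantage-23286; prover qn-prover-3 g16.

At a position `k` where the register is symmetric (`reg S (cornerFlip n k x) = reg S x` for every `x`, e.g. by `reg_cornerFlip_free` on a
hub-free degenerate interval) the differential `D_k(x) = Σ_g (term_g(x) + term_g(σ_k x))` vanishes; only the observers of `k` contribute.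
THIS MODULE: a single ZONE FLIP strictly BETWEEN two groups of observers splits the vanishing differential.  If a zone `[z, z+m)` above `k`
contains no observer position and no observer read strictly inside, then flipping `p` equal bits there keeps the part of `D_k` carried by
the cuts below `z` and multiplies the part carried by the cuts at or above `z` by `ζ^{±p}` (`zone_split`); with symmetry at `k` for both
inputs, `D_below + D_from = 0` and `D_below + ζ^{±p} D_from = 0`, hence **`diffFrom_eq_zero`**: each far CLUSTER of observers of `k` has a
vanishing differential of its own, for every input.  This is the register-language entry point of the far-read lemma (effective far
observers of a degenerate position must cancel among themselves, cluster by cluster).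
WHAT THIS IS NOT: not U-c1 itself; separation NOT moved.
-/

namespace Summit.QuantumAdvantage.AdviceFreeQNC0.LocalEngine

open Finset Classical

namespace RungU

variable {p n : ℕ}

/-- the pair term of cut `g` in the differential of the transposition at `k`. -/
noncomputable def pairTerm (S : ThreeStep p n) (k : ℕ) (x : Fin n → Bool) (g : Fin (n + 1)) : F4 :=
  term S x g + term S (cornerFlip n k x) g

/-- the part of `D_k` carried by the cuts positioned below `z` … -/
noncomputable def diffBelow (S : ThreeStep p n) (k z : ℕ) (x : Fin n → Bool) : F4 :=
  ∑ g ∈ univ.filter (fun g : Fin (n + 1) => g.val < z), pairTerm S k x g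

/-- … and by the cuts positioned at or above `z`. -/
noncomputable def diffFrom (S : ThreeStep p n) (k z : ℕ) (x : Fin n → Bool) : F4 :=
  ∑ g ∈ univ.filter (fun g : Fin (n + 1) => ¬ g.val < z), pairTerm S k x g

/-- `D_k = D_below + D_from`. -/
theorem diff_eq_below_add_from (S : ThreeStep p n) (k z : ℕ) (x : Fin n → Bool) :
    diff S k x = diffBelow S k z x + diffFrom S k z x := by
  unfold diff reg diffBelow diffFrom pairTerm
  rw [← Finset.sum_add_distrib, Finset.sum_filter_add_sum_filter_not]

/-- a non-observer's pair term vanishes. -/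
theorem pairTerm_of_not_observes (S : ThreeStep p n) (k : ℕ) (x : Fin n → Bool) (g : Fin (n + 1)) (h : ¬ Observes S g k) :
    pairTerm S k x g = 0 := by
  unfold pairTerm
  have hno : g.val ≠ k ∧ S.s g ≠ k ∧ S.t g ≠ k := by unfold Observes at h; push Not at h; exact h
  rw [term_congr S g (ThreeStep.y_cornerFlip S k x g hno.2.1 hno.2.2) (wtPrefix_cornerFlip k x hno.1), F4_add_self]

/-- symmetry at `k` makes the differential vanish. -/
theorem diff_eq_zero_of_sym (S : ThreeStep p n) (k : ℕ) (x : Fin n → Bool) (h : reg S (cornerFlip n k x) = reg S x) :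
    diff S k x = 0 := by
  unfold diff; rw [h, F4_add_self]

/-- reverse label shift: prefix count SMALLER by `m` ⇒ the term is multiplied by `ζ^{−m}`. -/
theorem term_shift_rev (S : ThreeStep p n) {x x' : Fin n → Bool} (g : Fin (n + 1)) (m : ℕ)
    (hJ : S.y g x' = S.y g x) (hN : wtPrefix x' g.val + m = wtPrefix x g.val) :
    term S x' g = rotZ (-((m : ℕ) : ZMod 3)) (term S x g) := by
  have h := term_shift S g m hJ.symm hN.symm
  rw [h, ← rotZ_add, neg_add_cancel, rotZ_zero]

/-- **ZONE SPLIT.** A zone flip above `k` whose zone contains no observer position and no observer read strictly inside keeps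
`D_below` and rotates `D_from` by `ζ^{s}`, where `W` moves by `s = ±p`. -/
theorem zone_split (S : ThreeStep p n) {k z m : ℕ} (hk1 : 1 ≤ k) (hkn : k < n) (hkz : k < z) {x : Fin n → Bool} {F : Finset (Fin n)}
    (hF : ZoneFlip p x F z m) (hzn : z + m ≤ n)
    (hpos : ∀ g : Fin (n + 1), Observes S g k → g.val < z ∨ z + m ≤ g.val)
    (hreads : ∀ r ∈ obsReads S k, ¬ (z < r ∧ r < z + m)) :
    ∃ s : ZMod 3, (s = ((p : ℕ) : ZMod 3) ∨ s = -((p : ℕ) : ZMod 3)) ∧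
      ((wt (flipOn F x) : ℕ) : ZMod 3) = ((wt x : ℕ) : ZMod 3) + s ∧
      diffBelow S k z (flipOn F x) = diffBelow S k z x ∧ diffFrom S k z (flipOn F x) = rotZ s (diffFrom S k z x) := by
  set x' := flipOn F x with hx'
  -- agreement below z, also after the transposition
  have hag : ∀ i : Fin n, i.val < z → x' i = x i := fun i hi => hF.apply_of_lt hi
  have hagσ : ∀ i : Fin n, i.val < z → cornerFlip n k x' i = cornerFlip n k x i := by
    intro i hi
    by_cases h1 : i.val + 1 = k
    · have e : i = ⟨k - 1, by omega⟩ := Fin.ext (by simp; omega)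
      rw [e, cornerFlip_apply_left k x' (by omega) hkn, cornerFlip_apply_left k x (by omega) hkn]
      exact hag _ (by simp; omega)
    · by_cases h2 : i.val = k
      · have e : i = ⟨k, hkn⟩ := Fin.ext (by simpa using h2)
        rw [e, cornerFlip_apply_right k x' (by omega) hkn, cornerFlip_apply_right k x (by omega) hkn]
        exact hag _ (by simp; omega)
      · rw [DensePeel.cornerFlip_apply_of_ne k x' i h1 h2, DensePeel.cornerFlip_apply_of_ne k x i h1 h2]
        exact hag i hi
  have hNb : ∀ r, r ≤ z → wtPrefix x' r = wtPrefix x r := fun r hr =>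
    DensePeel.wtPrefix_congr_below x' x r fun i hi => hag i (by omega)
  have hNbσ : ∀ r, r ≤ z → wtPrefix (cornerFlip n k x') r = wtPrefix (cornerFlip n k x) r := fun r hr =>
    DensePeel.wtPrefix_congr_below _ _ r fun i hi => hagσ i (by omega)
  have hwt : wt x' % p = wt x % p := hF.wt_mod_eq hzn
  -- residues at observer reads, also after the transposition
  have hres : ∀ r ∈ obsReads S k, wtPrefix x' r % p = wtPrefix x r % p := fun r hr => hF.wtPrefix_mod_eq (hreads r hr)
  have hσres : ∀ r, wtPrefix x' r % p = wtPrefix x r % p →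
      wtPrefix (cornerFlip n k x') r % p = wtPrefix (cornerFlip n k x) r % p := by
    intro r hr
    by_cases hrk : r = k
    · rw [hrk, hNbσ k (by omega)]
    · rw [wtPrefix_cornerFlip k x' hrk, wtPrefix_cornerFlip k x hrk]; exact hr
  -- fire bits of observers are preserved
  have hJ : ∀ g : Fin (n + 1), Observes S g k → S.y g x' = S.y g x ∧ S.y g (cornerFlip n k x') = S.y g (cornerFlip n k x) := by
    intro g ho
    obtain ⟨m1, m2⟩ := mem_obsReads S k ho
    exact ⟨y_congr_of_mod S g (hres _ m1) (hres _ m2) hwt,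
      y_congr_of_mod S g (hσres _ (hres _ m1)) (hσres _ (hres _ m2)) (by rw [wt_cornerFlip, wt_cornerFlip]; exact hwt)⟩
  -- labels above the zone: shifted by ±p, uniformly
  rcases hF.const with hc | hc
  · -- flipping zeros: + p
    refine ⟨((p : ℕ) : ZMod 3), Or.inl rfl, ?_, ?_, ?_⟩
    · rw [Coset21.wt_eq_wtPrefix, Coset21.wt_eq_wtPrefix, hx', wtPrefix_flipOn_false F x hc n,
        Finset.filter_true_of_mem (fun i _ => i.isLt), hF.card_eq, Nat.cast_add]
    · unfold diffBelow
      apply Finset.sum_congr rfl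
      intro g hg
      rw [Finset.mem_filter] at hg
      by_cases ho : Observes S g k
      · unfold pairTerm
        rw [term_congr S g (hJ g ho).1 (hNb g.val (by omega)), term_congr S g (hJ g ho).2 (hNbσ g.val (by omega))]
      · rw [pairTerm_of_not_observes S k _ g ho, pairTerm_of_not_observes S k _ g ho]
    · unfold diffFrom
      rw [rotZ_sum]
      apply Finset.sum_congr rfl
      intro g hg
      rw [Finset.mem_filter] at hg
      by_cases ho : Observes S g k
      · have hgz : z + m ≤ g.val := by rcases hpos g ho with h | h <;> omega
        have eF : (F.filter fun i => i.val < g.val) = F :=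
          Finset.filter_true_of_mem fun i hi => by have := (hF.inside i hi).2; omega
        have hN1 : wtPrefix x' g.val = wtPrefix x g.val + p := by
          rw [hx', wtPrefix_flipOn_false F x hc g.val, eF, hF.card_eq]
        have hgk : g.val ≠ k := by omega
        have hN2 : wtPrefix (cornerFlip n k x') g.val = wtPrefix (cornerFlip n k x) g.val + p := by
          rw [wtPrefix_cornerFlip k x' hgk, wtPrefix_cornerFlip k x hgk, hN1]
        unfold pairTerm
        rw [term_shift S g p (hJ g ho).1 hN1, term_shift S g p (hJ g ho).2 hN2, rotZ_map_add]
      · rw [pairTerm_of_not_observes S k _ g ho, pairTerm_of_not_observes S k _ g ho, rotZ_map_zero]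
  · -- flipping ones: − p
    refine ⟨-((p : ℕ) : ZMod 3), Or.inr rfl, ?_, ?_, ?_⟩
    · have h := wtPrefix_flipOn_true F x hc n
      rw [Finset.filter_true_of_mem (fun i _ => i.isLt), hF.card_eq] at h
      rw [Coset21.wt_eq_wtPrefix, Coset21.wt_eq_wtPrefix, hx', ← h, Nat.cast_add]; ring
    · unfold diffBelow
      apply Finset.sum_congr rfl
      intro g hg
      rw [Finset.mem_filter] at hg
      by_cases ho : Observes S g k
      · unfold pairTerm
        rw [term_congr S g (hJ g ho).1 (hNb g.val (by omega)), term_congr S g (hJ g ho).2 (hNbσ g.val (by omega))]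
      · rw [pairTerm_of_not_observes S k _ g ho, pairTerm_of_not_observes S k _ g ho]
    · unfold diffFrom
      rw [rotZ_sum]
      apply Finset.sum_congr rfl
      intro g hg
      rw [Finset.mem_filter] at hg
      by_cases ho : Observes S g k
      · have hgz : z + m ≤ g.val := by rcases hpos g ho with h | h <;> omega
        have eF : (F.filter fun i => i.val < g.val) = F :=
          Finset.filter_true_of_mem fun i hi => by have := (hF.inside i hi).2; omega
        have hN1 : wtPrefix x' g.val + p = wtPrefix x g.val := by
          have h := wtPrefix_flipOn_true F x hc g.val
          rw [eF, hF.card_eq] at h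
          rw [hx']; exact h
        have hgk : g.val ≠ k := by omega
        have hN2 : wtPrefix (cornerFlip n k x') g.val + p = wtPrefix (cornerFlip n k x) g.val := by
          rw [wtPrefix_cornerFlip k x' hgk, wtPrefix_cornerFlip k x hgk, hN1]
        unfold pairTerm
        rw [term_shift_rev S g p (hJ g ho).1 hN1, term_shift_rev S g p (hJ g ho).2 hN2, rotZ_map_add]
      · rw [pairTerm_of_not_observes S k _ g ho, pairTerm_of_not_observes S k _ g ho, rotZ_map_zero]

/-- `y + ζ^s y = 0` with `s ≠ 0` forces `y = 0`. -/
theorem eq_zero_of_add_rotZ (s : ZMod 3) (hs : s ≠ 0) (y : F4) (h : y + rotZ s y = 0) : y = 0 := by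
  revert s y; decide

/-- **CLUSTER VANISHING.** With register symmetry at `k` (for all inputs), a zone flip above `k` separating the observers (no observer
position in the zone, no observer read strictly inside) shows that the observers at or above the zone carry a vanishing differential on
their own: `D_from(x) = 0` (and hence `D_below(x) = 0`), `3 ∤ p`. -/
theorem diffFrom_eq_zero (hp3 : p % 3 ≠ 0) (S : ThreeStep p n) {k z m : ℕ} (hk1 : 1 ≤ k) (hkn : k < n) (hkz : k < z)
    (hsym : ∀ y : Fin n → Bool, reg S (cornerFlip n k y) = reg S y) {x : Fin n → Bool} {F : Finset (Fin n)}
    (hF : ZoneFlip p x F z m) (hzn : z + m ≤ n)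
    (hpos : ∀ g : Fin (n + 1), Observes S g k → g.val < z ∨ z + m ≤ g.val)
    (hreads : ∀ r ∈ obsReads S k, ¬ (z < r ∧ r < z + m)) :
    diffFrom S k z x = 0 ∧ diffBelow S k z x = 0 := by
  obtain ⟨s, hs, _, hB, hR⟩ := zone_split S hk1 hkn hkz hF hzn hpos hreads
  have hs0 : s ≠ 0 := by
    have hpz := cast_p_ne_zero hp3
    rcases hs with rfl | rfl
    · exact hpz
    · exact neg_ne_zero.mpr hpz
  have d0 : diffBelow S k z x + diffFrom S k z x = 0 := by
    rw [← diff_eq_below_add_from]; exact diff_eq_zero_of_sym S k x (hsym x)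
  have d1 : diffBelow S k z x + rotZ s (diffFrom S k z x) = 0 := by
    rw [← hB, ← hR, ← diff_eq_below_add_from]; exact diff_eq_zero_of_sym S k _ (hsym _)
  have key : ∀ (a b c : F4), a + b = 0 → a + c = 0 → b + c = 0 := by decide
  have h := eq_zero_of_add_rotZ s hs0 _ (key _ _ _ d0 d1)
  refine ⟨h, ?_⟩
  rw [h, add_zero] at d0
  exact d0

end RungU

end Summit.QuantumAdvantage.AdviceFreeQNC0.LocalEngine
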